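import Mathlib
import Literature.AlgebraicGeometry.Resolution.AbhyankarMonomialUniformization
import Literature.AlgebraicGeometry.Resolution.RsopMonomialIdeals
import HarnessLib

/-!
# Route `RadicialJung`, crux `CleanModels` (stmt-15917): the UNGUARDED typing `KnafKuhlmann2005_Thm11_monomial` is false as typed
# (kernel certificate); the corrected fact is `KnafKuhlmann2005_Thm11_monomialForm`

Explicit-unit seat `decomp-res-hand-2` g2.  HYGIENE, counted 0.  This seat typed Knaf–Kuhlmann 2005 Thm. 1.1 with its monomiality clause as
`Literature.AlgebraicGeometry.Resolution.KnafKuhlmann2005_Thm11_monomial` (relocated by the gate, ✓ p792590) and consumed it in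
`…AbhyankarKK05.lean` (✓ p792985).  That typing asks the monomial form `ζ = u ∏ aᵢ^{μᵢ}` (`u` a unit of the regular local ring at the centre)
for EVERY element `ζ` of the prescribed finite set `Z ⊂ 𝒪_P` — including `ζ = 0`, impossible in a domain (the source's `𝒪`-monomials, p. 2,
are non-zero by definition).  Hence the typing is FALSE; this file proves it (`knafKuhlmann2005_Thm11_monomial_false`, witness `k = K = ℚ`,
trivial valuation, `Z = {0}`), so that the three theorems of `…AbhyankarKK05.lean` are recorded as VACUOUSLY conditional.  The corrected fact
`Literature.AlgebraicGeometry.Resolution.KnafKuhlmann2005_Thm11_monomialForm` (monomial form for `ζ ≠ 0`; ✓ p793207) and its consumers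
`…AbhyankarKnafKuhlmann.lean` supersede them.  Literature/ holds only published statements, so the certificate lives here.
-/

noncomputable section

set_option linter.dupNamespace false -- mandated namespace of this single-conjunct summit

namespace Summit.ResolutionOfSingularities.ResolutionOfSingularities.Theorems.RadicialJung.CleanModels

open IsLocalRing Literature.AlgebraicGeometry.Resolution

/-- **The unguarded typing `KnafKuhlmann2005_Thm11_monomial` is FALSE AS TYPED** (typing error of seat `decomp-res-hand-2` g2, not of the
source): it asks the monomial form `ζ = u ∏ aᵢ^{μᵢ}` with `u` a UNIT for every `ζ` of the prescribed finite set `Z ⊂ 𝒪_P`, including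
`ζ = 0`, which is impossible in a domain (the source's `𝒪`-monomials, p. 2, are non-zero by definition).  Witness: `k = K = ℚ`, the trivial
valuation (an Abhyankar place with residue field `ℚ`), `Z = {0}`.  The corrected typing is `KnafKuhlmann2005_Thm11_monomialForm` (monomial form
for `ζ ≠ 0`). [folklore] -/
theorem knafKuhlmann2005_Thm11_monomial_false :
    ¬ Literature.AlgebraicGeometry.Resolution.KnafKuhlmann2005_Thm11_monomial.{0} := by
  intro h
  have hk : ∀ c : ℚ, algebraMap ℚ ℚ c ∈ (⊤ : ValuationSubring ℚ) := fun c => ValuationSubring.mem_top _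
  have hFG : (⊤ : IntermediateField ℚ ℚ).FG := IntermediateField.fg_of_noetherian ⊤
  have htd : transcendenceDefect ℚ (⊤ : ValuationSubring ℚ) hk = 0 := transcendenceDefect_top hk
  letI alg : Algebra ℚ (ResidueField (⊤ : ValuationSubring ℚ)) :=
    ((IsLocalRing.residue (⊤ : ValuationSubring ℚ)).comp ((algebraMap ℚ ℚ).codRestrict (⊤ : ValuationSubring ℚ) hk)).toAlgebra
  have halgmap : ∀ a : (⊤ : ValuationSubring ℚ),
      algebraMap ℚ (ResidueField (⊤ : ValuationSubring ℚ)) (a : ℚ) = IsLocalRing.residue _ a := fun a => rfl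
  haveI : Algebra.IsIntegral ℚ (ResidueField (⊤ : ValuationSubring ℚ)) := by
    refine ⟨fun x => ?_⟩
    obtain ⟨a, rfl⟩ := IsLocalRing.residue_surjective x
    rw [← halgmap a]
    exact isIntegral_algebraMap
  haveI : Algebra.IsAlgebraic ℚ (ResidueField (⊤ : ValuationSubring ℚ)) := Algebra.IsIntegral.isAlgebraic
  have hsep : Algebra.IsSeparable ℚ (ResidueField (⊤ : ValuationSubring ℚ)) :=
    Algebra.IsAlgebraic.isSeparable_of_perfectField
  obtain ⟨A', -, -, -, -, hreg, d, a, hspan, hdim, hmono⟩ :=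
    h ℚ ℚ hFG ⊤ hk htd hsep {0} (fun z _ => ValuationSubring.mem_top z)
  obtain ⟨v, μ, hv, h0⟩ := hmono 0 (Finset.mem_singleton_self 0)
  haveI := hreg
  -- the parameters are non-zero (part of a regular system of parameters), the unit is non-zero
  have hd' : (maximalIdeal (locAtCentre A'.toSubring (⊤ : ValuationSubring ℚ))).spanFinrank = d := by
    have h1 := IsRegularLocalRing.spanFinrank_maximalIdeal (R := locAtCentre A'.toSubring (⊤ : ValuationSubring ℚ))
    rw [hdim] at h1
    exact_mod_cast h1
  have har : IsRsopPart a := isRsopPart_comp_of_rsop hd' a hspan id Function.injective_id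
  have ha0 : ∀ i, ((a i : locAtCentre A'.toSubring (⊤ : ValuationSubring ℚ)) : ℚ) ≠ 0 :=
    fun i hi => har.ne_zero i (Subtype.ext hi)
  have hv0 : ((v : locAtCentre A'.toSubring (⊤ : ValuationSubring ℚ)) : ℚ) ≠ 0 :=
    fun hv' => hv.ne_zero (Subtype.ext hv')
  have hne : (v : ℚ) * ∏ i, ((a i : locAtCentre A'.toSubring (⊤ : ValuationSubring ℚ)) : ℚ) ^ (μ i) ≠ 0 :=
    mul_ne_zero hv0 (Finset.prod_ne_zero_iff.mpr fun i _ => pow_ne_zero _ (ha0 i))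
  exact hne h0.symm

end Summit.ResolutionOfSingularities.ResolutionOfSingularities.Theorems.RadicialJung.CleanModels

end
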